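import Summits.BirchSwinnertonDyer.BirchSwinnertonDyer.Theorems.AdditiveBranchIMCGordTwoRankOneHeegnerKolyvaginEquivalence
import Summits.BirchSwinnertonDyer.BirchSwinnertonDyer.Theorems.AdditiveBranchIMCGordTwoRankOneHeegnerKolyvaginBSDp
import HarnessLib

/-!
# Route `AdditiveBranchIMC` (rung K1), crux `GordTwoRankOne` (item 19358): the Heegner–Kolyvagin road,
# Part 13 — the Serre-keyed crux BY NAME and the class-level `BSD(E,p)` door, both read off the registered
# support item `AdjustedHeegnerIndexBoundTowerSurj` (stmt-20498) (lane `bsd-addord-k1-c3x`, gen 2; `--supports` only)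

HONEST FRAMING. THEOREMS ONLY: no definition, no new named fact, no `sorry`; nothing is booked; items
19358 / 19357 / 20498 stay OPEN; «BSD is not proved by any of this». Two one-line re-pointings that Part 12
(`…HeegnerKolyvaginItem`) deferred because they sit on Parts 10/11:

* `gordTwoRankOne_of_item_of_rest'` — Part 10's Serre-keyed crux BY NAME with `hL'` read off item 20498:
  PUB + item 20498 + Li–Liu–Tian on the CM rows + the crux DISPLAYED on «non-CM ∧ p ≥ 5 ∧ ¬surj(p)» and
  «non-CM ∧ p = 3 ∧ ¬towerSurj(3)» ⟹ `GordTwoRankOne`;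
* `cellGordTwo_bsdp_rankOne_of_surj_of_item_of_twistLower` — Part 11's CLASS-LEVEL `BSDp W p` on the
  surjective rank-one rows of cell (G-ord, `e = 2`) at `p ≥ 11`, `p ∤ ∏c_ℓ(E)`, from PUB + item 20498 + the
  rank-zero LOWER half at the Heegner-field twists (crux 19357's conclusion there): Schneider-free, without
  any `p`-adic Gross–Zagier formula or Λ-adic branch object.

References: [JetchevSkinnerWan2017] §7.4.1–§7.4.3; [SerreAbelianLadic1968] IV-23; [McCallumLMS1991] §1;
[EdixhovenManin1991] Thm. 3; [LiLiuTian2024] Thm. 1.1 (i); [Miller2011LMS] Def. 1.1.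
-/

set_option autoImplicit false
set_option linter.dupNamespace false
noncomputable section

open scoped Classical NumberField
open WeierstrassCurve NumberField IsDedekindDomain
  Literature.NumberTheory.EllipticCurves Literature.NumberTheory.EllipticCurves.ModularForms
  Literature.NumberTheory.EllipticCurves.Rank1Residual
  Literature.NumberTheory.EllipticCurves.Rank1Residual.Typed
  Summit.BirchSwinnertonDyer.Rank1Residual
  Summit.BirchSwinnertonDyer.Rank1Residual.Additive
  Summit.BirchSwinnertonDyer.Rank1Residual.X11b
  Summit.BirchSwinnertonDyer.Rank1Residual.GaloisImage
  Literature.NumberTheory.Automorphic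
  Summit.BirchSwinnertonDyer.BirchSwinnertonDyer.Theses.AdditiveBranchIMC

namespace Summit.BirchSwinnertonDyer.BirchSwinnertonDyer.Theorems.AdditiveBranchIMCGordTwoRankOne.HeegnerKolyvagin

/-! ### §26 Two doors on item 20498 -/

/-- **The same with the complement keyed on the census bits** (Part 10 §21, Serre IV-23 at `p ≥ 5`):
item 20498 + PUB + LLT on CM + `hRest5` («non-CM ∧ p ≥ 5 ∧ ¬surj(p)») + `hRest3` («non-CM ∧ p = 3 ∧
¬towerSurj(3)») ⟹ `GordTwoRankOne`. Nothing booked. [cite: SerreAbelianLadic1968, Ch. IV §3.4, Lemma 3 (IV-23)]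
[cite: JetchevSkinnerWan2017, §7.4.1 (pp. 29–31)] [cite: Miller2011LMS, Def. 1.1] -/
theorem gordTwoRankOne_of_item_of_rest'
    (hGZ : ∀ (N : ℕ) [NeZero N] (W : WeierstrassCurve ℚ) (K : Type) [Field K] [NumberField K],
      gross_zagier N W K)
    (hKo : ∀ (N : ℕ) [NeZero N] (W : WeierstrassCurve ℚ) (K : Type) [Field K] [NumberField K],
      kolyvagin N W K)
    (hKatoT : Kato2004.rankZero_padicValNat_sha_add_padicValNat_tamagawa_le_of_additive_potGood_of_imageContainsSL2)
    (hGZK : rank_eq_analyticRank_of_analyticRank_le_one) (hmod : hasEntireLFunction_rat)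
    (hnf : exists_isNewformOf) (hmodP : nonempty_modularParametrizationData)
    (hFH : friedbergHoffstein_exists_heegnerField_split_twist_ne_zero)
    (hLLT : LiLiuTian2024.thm11_bsdp_of_cm_rank_one)
    (hL' : AdjustedHeegnerIndexBoundTowerSurj)
    (hRest5 : ∀ (W : WeierstrassCurve ℚ) [W.IsElliptic] [W.IsGloballyMinimal] (p : ℕ) [Fact p.Prime],
      W.analyticRank = 1 → N10.CellGordTwo W p → 5 ≤ p → ¬ W.HasCM →
      ¬ W.HasSurjectiveModNGaloisRep p → Typed.MissingLowerBoundAt W p)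
    (hRest3 : ∀ (W : WeierstrassCurve ℚ) [W.IsElliptic] [W.IsGloballyMinimal] (p : ℕ) [Fact p.Prime],
      W.analyticRank = 1 → N10.CellGordTwo W p → p = 3 → ¬ W.HasCM →
      ¬ (∀ n : ℕ, W.HasSurjectiveModNGaloisRep (p ^ n : ℕ)) → Typed.MissingLowerBoundAt W p) :
    GordTwoRankOne :=
  gordTwoRankOne_of_adjustedIndexBound_of_rest' hGZ hKo hKatoT hGZK hmod hnf hmodP hFH hLLT
    (fun W _ _ p _ N _ K _ _ Dt H ι P Wd _ _ Cd ↦ hL' W p N K Dt H ι P Wd Cd) hRest5 hRest3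



/-- **`BSD(E,p)` (both halves) on the surjective rows at `p ≥ 11`, `p ∤ ∏c_ℓ(E)`, from item 20498 + the
rank-zero LOWER half at the Heegner-field twists + PUBLISHED facts** — Part 11's
`cellGordTwo_bsdp_rankOne_of_surj_of_adjustedIndexBound_of_twistLower` with `hL'` read off the item.
No `p`-adic height, no `p`-adic Gross–Zagier, no Schneider, no A′. Nothing booked; both inputs OPEN.
[cite: JetchevSkinnerWan2017, §7.4.1–§7.4.3 (pp. 29–31)] [cite: McCallumLMS1991, §1 Theorem (Kolyvagin), p. 296]
[cite: EdixhovenManin1991, Thm. 3] [cite: Miller2011LMS, §1 and Def. 1.1] -/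
theorem cellGordTwo_bsdp_rankOne_of_surj_of_item_of_twistLower
    (hGZ : ∀ (N : ℕ) [NeZero N] (W : WeierstrassCurve ℚ) (K : Type) [Field K] [NumberField K],
      gross_zagier N W K)
    (hKo : ∀ (N : ℕ) [NeZero N] (W : WeierstrassCurve ℚ) (K : Type) [Field K] [NumberField K],
      kolyvagin N W K)
    (hB : ∀ (N : ℕ) [NeZero N] (W : WeierstrassCurve ℚ) (K : Type) [Field K] [NumberField K],
      Kolyvagin1990_padicValNat_card_sha_le N W K)
    (hKatoT : Kato2004.rankZero_padicValNat_sha_add_padicValNat_tamagawa_le_of_additive_potGood_of_imageContainsSL2)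
    (hGZK : rank_eq_analyticRank_of_analyticRank_le_one) (hmod : hasEntireLFunction_rat)
    (hnf : exists_isNewformOf) (hmodP : nonempty_modularParametrizationData)
    (hFH : friedbergHoffstein_exists_heegnerField_split_twist_ne_zero)
    (hEdxK : edixhoven_not_dvd_maninConstant_of_kodairaSymbol_ne)
    (hNS : integral_neronScaling_of_isGloballyMinimal)
    (hL' : AdjustedHeegnerIndexBoundTowerSurj)
    (hTwL : ∀ (W : WeierstrassCurve ℚ) [W.IsElliptic] [W.IsGloballyMinimal] (p : ℕ) [Fact p.Prime]
      (K : Type) [Field K] [NumberField K]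
      (Wd : WeierstrassCurve ℚ) [Wd.IsElliptic] [Wd.IsGloballyMinimal] (Cd : VariableChange ℚ),
      W.analyticRank = 1 → N10.CellGordTwo W p → (∀ n : ℕ, W.HasSurjectiveModNGaloisRep (p ^ n : ℕ)) →
      IsImaginaryQuadratic K → SatisfiesHeegnerHypothesis (W.conductorNorm ℤ) K →
      (W.quadraticTwist (NumberField.discr K : ℚ)).entireLFunction 1 ≠ 0 →
      Cd • W.quadraticTwist (NumberField.discr K : ℚ) = Wd → Typed.MissingLowerBoundAt Wd p) :
    ∀ (W : WeierstrassCurve ℚ) [W.IsElliptic] [W.IsGloballyMinimal] (p : ℕ) [Fact p.Prime],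
      W.analyticRank = 1 → N10.CellGordTwo W p → 11 ≤ p → W.HasSurjectiveModNGaloisRep p →
      ¬ p ∣ W.tamagawaProduct → BSDp W p :=
  cellGordTwo_bsdp_rankOne_of_surj_of_adjustedIndexBound_of_twistLower hGZ hKo hB hKatoT hGZK hmod hnf hmodP
    hFH hEdxK hNS (fun W _ _ p _ N _ K _ _ Dt H ι P Wd _ _ Cd ↦ hL' W p N K Dt H ι P Wd Cd) hTwL

end Summit.BirchSwinnertonDyer.BirchSwinnertonDyer.Theorems.AdditiveBranchIMCGordTwoRankOne.HeegnerKolyvagin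

end
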